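import Summits.QuantumFields.YangMills.Theorems.LuscherReductionOneSiteLevelsKacCutoff

/-!
# INNER, flat lane (layer III): min–max lower bounds on the orthogonal complement of an eigenfamily

Support module of crux `OneSiteLevels` (route `LuscherReduction`, item stmt-QuantumFields-20007), FLAT lane of the
registered v12 stub `stub_flatKacAL1` (STUB-PLAN rev 3 rows III.6 = H3″ and III.7 = H3‴).

For an AL1 eigenfamily `f_0, …, f_m` (`IsEigenFamily m f`: orthonormal classical eigenfunctions of `𝔥 = −½Δ + V` for the
min–max levels `E_j = physLevel (j+1)`) and an admissible `u ∈ IsKacFn`: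

* H3″ `physLevel_mul_l2sq_le_energyForm`: `u ⊥ f_0, …, f_{k−1}` (`k ≤ m+1`) ⇒ `E_k ‖u‖² ≤ 𝔮(u)`.
  Proof by induction on `k` through the cut-off lemma G5 (`physLevel_le_of_family`) applied to the admissible
  orthonormal family `(f_0, …, f_{k−1}, u/‖u‖)`, whose energy matrix is `diag(E_0, …, E_{k−1}, 𝔮(u)/‖u‖²)` by Green's identity
  (`energyBil_eigen`); degenerate clusters `E_{k−1} = E_k` are absorbed by the induction hypothesis.  NO completeness of the
  eigenfamily is used.
* H3‴ `physLevel_mul_sub_le_energyForm`: `E_{m+1} (‖u‖² − Σ_j ⟨u,f_j⟩²) ≤ 𝔮(u)` for every admissible `u`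
  (subtract the projection, Pythagoras, `energyForm_add_span_of_orthogonal`, H3″ at `k = m+1`).

Real analysis only ([folklore]); NOT the stub; femto rung R2b1; NOT a claim about the gap.
References: M. Reed, B. Simon IV, Thm. XIII.1–2, XIII.64.
-/

set_option autoImplicit false

noncomputable section

open MeasureTheory Filter Topology Real
open Literature.Analysis.OperatorTheory.YMMatrixModel

namespace Summit.QuantumFields.YangMills.Theorems.FemtoTransferGap

section MinMax

variable {m : ℕ} {f : Fin (m + 1) → ZM → ℝ} {u : ZM → ℝ}

/-- `l2sq (a • u) = a² l2sq u` in the `fun` form. [folklore] -/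
theorem l2sq_const_mul (a : ℝ) (u : ZM → ℝ) : l2sq (fun x => a * u x) = a ^ 2 * l2sq u := by
  have h := l2sq_smul u a
  simpa [Pi.smul_def, smul_eq_mul] using h

/-- **The one-step family bound.**  For `k' ≤ m+1`, an admissible `u` with `‖u‖² > 0` orthogonal to `f_0, …, f_{k'−1}`, and
any `B ≥ 0` dominating `E_0, …, E_{k'−1}`:  `physLevel (k'+1) ≤ max B (𝔮(u)/‖u‖²)` — the cut-off lemma applied to the
orthonormal admissible family `(f_0, …, f_{k'−1}, u/‖u‖)`. [cite: ReedSimonIV1978, Thm. XIII.1] -/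
theorem physLevel_succ_le_max_of_orthogonal {k' : ℕ} (hk' : k' ≤ m + 1) (hf : IsEigenFamily m f) (hu : IsKacFn u)
    (hpos : 0 < l2sq u) (horth : ∀ j : Fin (m + 1), (j : ℕ) < k' → ∫ x, u x * f j x = 0)
    {B : ℝ} (hB0 : 0 ≤ B) (hB : ∀ j : Fin (m + 1), (j : ℕ) < k' → physLevel ((j : ℕ) + 1) ≤ B) :
    physLevel (k' + 1) ≤ max B (energyForm u / l2sq u) := by
  -- the normalised `u`
  set c : ℝ := (Real.sqrt (l2sq u))⁻¹ with hc
  have hsq : Real.sqrt (l2sq u) ^ 2 = l2sq u := Real.sq_sqrt hpos.le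
  have hc2 : c ^ 2 * l2sq u = 1 := by
    rw [hc, inv_pow, hsq, inv_mul_cancel₀ hpos.ne']
  have hcu : IsKacFn (c • u) := hu.smul c
  -- the family
  let emb : Fin k' → Fin (m + 1) := fun i => ⟨i, lt_of_lt_of_le i.2 hk'⟩
  have hemb : ∀ i : Fin k', ((emb i : Fin (m + 1)) : ℕ) = i := fun i => rfl
  let G : Fin (k' + 1) → ZM → ℝ := Fin.snoc (fun i => f (emb i)) (c • u)
  have hGc : ∀ i : Fin k', G (Fin.castSucc i) = f (emb i) := fun i => by simp [G]
  have hGl : G (Fin.last k') = c • u := by simp [G]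
  have hGmem : ∀ i, IsKacFn (G i) := fun i => by
    refine Fin.lastCases ?_ (fun i => ?_) i
    · rw [hGl]; exact hcu
    · rw [hGc]; exact isKacFn_of_isEigenFamily hf _
  -- inner products
  have huf : ∀ i : Fin k', ∫ x, (c • u) x * f (emb i) x = 0 := fun i => by
    have e : ∫ x, (c • u) x * f (emb i) x = c * ∫ x, u x * f (emb i) x := by
      rw [← integral_const_mul]; exact integral_congr_ae (Eventually.of_forall fun x => by
        simp only [Pi.smul_apply, smul_eq_mul]; ring)
    rw [e, horth (emb i) (by rw [hemb]; exact i.2), mul_zero]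
  have hfu : ∀ i : Fin k', ∫ x, f (emb i) x * (c • u) x = 0 := fun i => by
    rw [← huf i]; exact integral_congr_ae (Eventually.of_forall fun x => by ring)
  have huu : ∫ x, (c • u) x * (c • u) x = 1 := by
    have e : ∫ x, (c • u) x * (c • u) x = c ^ 2 * l2sq u := by
      rw [l2sq, ← integral_const_mul]
      exact integral_congr_ae (Eventually.of_forall fun x => by simp only [Pi.smul_apply, smul_eq_mul]; ring)
    rw [e, hc2]
  have horthG : ∀ i j, ∫ x, G i x * G j x = if i = j then (1 : ℝ) else 0 := by
    intro i j
    refine Fin.lastCases ?_ (fun i => ?_) i <;> refine Fin.lastCases ?_ (fun j => ?_) j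
    · rw [hGl, if_pos rfl]; exact huu
    · rw [hGl, hGc, if_neg (Fin.castSucc_lt_last j).ne']; exact huf j
    · rw [hGl, hGc, if_neg (Fin.castSucc_lt_last i).ne]; exact hfu i
    · rw [hGc, hGc, hf.2.2.1]
      by_cases hij : i = j
      · subst hij; simp
      · have h1 : emb i ≠ emb j := fun h => hij (Fin.ext (by simpa [emb] using congrArg Fin.val h))
        have h2 : Fin.castSucc i ≠ Fin.castSucc j := fun h => hij (Fin.castSucc_injective _ h)
        rw [if_neg h1, if_neg h2]
  -- energy matrix entries
  have hQff : ∀ i j : Fin k', ∫ x, f (emb i) x * hApply (f (emb j)) x =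
      if i = j then physLevel ((j : ℕ) + 1) else 0 := fun i j => by
    have e : ∫ x, f (emb i) x * hApply (f (emb j)) x = physLevel (((emb j : Fin (m + 1)) : ℕ) + 1) *
        ∫ x, f (emb i) x * f (emb j) x := by
      rw [← integral_const_mul]
      refine integral_congr_ae (Eventually.of_forall fun x => ?_)
      show f (emb i) x * hApply (f (emb j)) x = _
      rw [hf.2.2.2.1 (emb j) x]; ring
    rw [e, hf.2.2.1, hemb]
    by_cases hij : i = j
    · subst hij; simp
    · have h1 : emb i ≠ emb j := fun h => hij (Fin.ext (by simpa [emb] using congrArg Fin.val h))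
      rw [if_neg h1, if_neg hij, mul_zero]
  have hQfu : ∀ i : Fin k', ∫ x, f (emb i) x * hApply (c • u) x = 0 := fun i => by
    rw [← energyBil_eq_integral_mul_hApply (isKacFn_of_isEigenFamily hf _) hcu, energyBil_eigen_left hf hcu, huf i, mul_zero]
  have hQuf : ∀ i : Fin k', ∫ x, (c • u) x * hApply (f (emb i)) x = 0 := fun i => by
    rw [← energyBil_eq_integral_mul_hApply hcu (isKacFn_of_isEigenFamily hf _), energyBil_eigen hf hcu, huf i, mul_zero]
  have hQuu : ∫ x, (c • u) x * hApply (c • u) x = energyForm u / l2sq u := by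
    rw [← energyForm_eq_integral_mul_hApply hcu, energyForm_smul' hu c, eq_div_iff hpos.ne', mul_assoc, mul_comm (energyForm u),
      ← mul_assoc, hc2, one_mul]
  -- the quadratic form bound
  set ρ := energyForm u / l2sq u with hρ
  have hρ0 : 0 ≤ ρ := div_nonneg (energyForm_nonneg u) hpos.le
  set s := max B ρ with hsdef
  have hs0 : 0 ≤ s := le_max_of_le_left hB0
  have hquad : ∀ a : Fin (k' + 1) → ℝ, ∑ i, ∑ j, a i * a j * ∫ x, G i x * hApply (G j) x ≤ s * ∑ i, a i ^ 2 := by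
    intro a
    -- split every sum into `castSucc` part and `last`
    rw [Fin.sum_univ_castSucc, Fin.sum_univ_castSucc]
    simp_rw [Fin.sum_univ_castSucc, hGc, hGl, hQff, hQfu, hQuf, hQuu]
    have hdiag : ∀ i : Fin k', ∑ j : Fin k', a (Fin.castSucc i) * a (Fin.castSucc j) *
        (if i = j then physLevel ((j : ℕ) + 1) else 0) = a (Fin.castSucc i) ^ 2 * physLevel ((i : ℕ) + 1) := by
      intro i
      rw [Finset.sum_eq_single i (fun j _ hji => by rw [if_neg (Ne.symm hji), mul_zero])
        (fun h => (h (Finset.mem_univ i)).elim)]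
      rw [if_pos rfl]; ring
    simp_rw [hdiag, mul_zero, add_zero, Finset.sum_const_zero, zero_add]
    have h1 : ∑ i : Fin k', a (Fin.castSucc i) ^ 2 * physLevel ((i : ℕ) + 1) ≤ ∑ i : Fin k', a (Fin.castSucc i) ^ 2 * s :=
      Finset.sum_le_sum fun i _ => mul_le_mul_of_nonneg_left
        ((hB (emb i) (by rw [hemb]; exact i.2)).trans (le_max_left _ _)) (sq_nonneg _)
    have h2 : a (Fin.last k') * a (Fin.last k') * ρ ≤ a (Fin.last k') ^ 2 * s := by
      rw [← sq]; exact mul_le_mul_of_nonneg_left (le_max_right _ _) (sq_nonneg _)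
    calc (∑ i : Fin k', a (Fin.castSucc i) ^ 2 * physLevel ((i : ℕ) + 1)) + a (Fin.last k') * a (Fin.last k') * ρ
        ≤ (∑ i : Fin k', a (Fin.castSucc i) ^ 2 * s) + a (Fin.last k') ^ 2 * s := add_le_add h1 h2
      _ = s * ((∑ i : Fin k', a (Fin.castSucc i) ^ 2) + a (Fin.last k') ^ 2) := by rw [← Finset.sum_mul]; ring
  exact physLevel_le_of_family G hGmem horthG hs0 hquad

/-- **H3″ — min–max lower bound on the orthogonal complement of the first `k` eigenfunctions**: for an AL1 eigenfamily
`f_0, …, f_m`, `k ≤ m+1`, and an admissible `u` with `⟨u, f_j⟩ = 0` for `j < k`:  `physLevel (k+1) · ‖u‖² ≤ 𝔮(u)`.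
(Induction on `k`; degenerate clusters `E_{k−1} = E_k` are absorbed by the induction hypothesis; no completeness used.)
[cite: ReedSimonIV1978, Thm. XIII.1] -/
theorem physLevel_mul_l2sq_le_energyForm {k : ℕ} (hkm : k ≤ m + 1) (hf : IsEigenFamily m f) (hu : IsKacFn u)
    (horth : ∀ j : Fin (m + 1), (j : ℕ) < k → ∫ x, u x * f j x = 0) :
    physLevel (k + 1) * l2sq u ≤ energyForm u := by
  -- trivial when `‖u‖² = 0`
  rcases (l2sq_nonneg u).eq_or_lt with h0 | hpos
  · rw [← h0, mul_zero]; exact energyForm_nonneg u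
  -- the genuine statement: `physLevel (k+1) ≤ 𝔮(u)/‖u‖²`, by induction on `k`
  suffices h : physLevel (k + 1) ≤ energyForm u / l2sq u by
    rwa [le_div_iff₀ hpos] at h
  induction k with
  | zero =>
    have h := physLevel_succ_le_max_of_orthogonal (k' := 0) (Nat.zero_le _) hf hu hpos (fun j hj => absurd hj (Nat.not_lt_zero _))
      le_rfl (fun j hj => absurd hj (Nat.not_lt_zero _))
    rwa [max_eq_right (div_nonneg (energyForm_nonneg u) hpos.le)] at h
  | succ k ih =>
    have ih' := ih (Nat.le_of_succ_le hkm) (fun j hj => horth j (Nat.lt_succ_of_lt hj))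
    have hmono : ∀ j : Fin (m + 1), (j : ℕ) < k + 1 → physLevel ((j : ℕ) + 1) ≤ physLevel (k + 1) := fun j hj =>
      physLevel_mono (Nat.succ_le_succ (Nat.zero_le _)) (Nat.succ_le_succ (Nat.le_of_lt_succ hj))
    have h := physLevel_succ_le_max_of_orthogonal hkm hf hu hpos horth
      (physLevel_nonneg (Nat.succ_le_succ (Nat.zero_le k))) hmono
    -- `max (E_k) ρ = ρ` since `E_k ≤ ρ` by the induction hypothesis
    rwa [max_eq_right ih'] at h

/-- Pythagoras for `u + Σ c_j f_j`: `‖u + Σ c_j f_j‖² = ‖u‖² + 2 Σ c_j ⟨u,f_j⟩ + Σ c_j²`. [cite: ReedSimonIV1978, Thm. XIII.64] -/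
theorem l2sq_add_span (hf : IsEigenFamily m f) (hu : IsKacFn u) (c : Fin (m + 1) → ℝ) :
    l2sq (u + fun x => ∑ j, c j * f j x) = l2sq u + 2 * (∑ j, c j * ∫ x, u x * f j x) + ∑ j, c j ^ 2 := by
  classical
  suffices h : ∀ s : Finset (Fin (m + 1)), l2sq (u + fun x => ∑ j ∈ s, c j * f j x) =
      l2sq u + 2 * (∑ j ∈ s, c j * ∫ x, u x * f j x) + ∑ j ∈ s, c j ^ 2 from h Finset.univ
  intro s
  induction s using Finset.induction_on with
  | empty =>
    have e : (u + fun x : ZM => ∑ j ∈ (∅ : Finset (Fin (m + 1))), c j * f j x) = u := by funext x; simp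
    rw [e]; simp
  | insert a s ha ih =>
    have hS : IsKacFn (fun x => ∑ j ∈ s, c j * f j x) := isKacFn_sum_smul s f (isKacFn_of_isEigenFamily hf) c
    have huS : IsKacFn (u + fun x => ∑ j ∈ s, c j * f j x) := hu.add hS
    have hfa : IsKacFn (f a) := isKacFn_of_isEigenFamily hf a
    have e : (u + fun x => ∑ j ∈ insert a s, c j * f j x) = (u + fun x => ∑ j ∈ s, c j * f j x) + c a • f a := by
      funext x; simp [Finset.sum_insert ha]; ring
    -- `‖w + c f_a‖² = ‖w‖² + 2c⟨w,f_a⟩ + c²‖f_a‖²`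
    set w : ZM → ℝ := u + fun x => ∑ j ∈ s, c j * f j x with hw
    have hexp : l2sq (w + c a • f a) = l2sq w + 2 * (c a * ∫ x, w x * f a x) + c a ^ 2 * l2sq (f a) := by
      have I1 : Integrable fun x => w x ^ 2 := huS.integrable_sq
      have I2 : Integrable fun x => 2 * (c a * (w x * f a x)) := ((huS.integrable_mul hfa).const_mul _).const_mul _
      have I3 : Integrable fun x => c a ^ 2 * f a x ^ 2 := hfa.integrable_sq.const_mul _
      have I12 : Integrable fun x => w x ^ 2 + 2 * (c a * (w x * f a x)) := I1.add I2
      calc l2sq (w + c a • f a) = ∫ x, (w x ^ 2 + 2 * (c a * (w x * f a x)) + c a ^ 2 * f a x ^ 2) := by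
            rw [l2sq]
            refine integral_congr_ae (Eventually.of_forall fun x => ?_)
            simp only [Pi.add_apply, Pi.smul_apply, smul_eq_mul]
            ring
        _ = (∫ x, w x ^ 2) + (∫ x, 2 * (c a * (w x * f a x))) + ∫ x, c a ^ 2 * f a x ^ 2 := by
            rw [integral_add I12 I3, integral_add I1 I2]
        _ = l2sq w + 2 * (c a * ∫ x, w x * f a x) + c a ^ 2 * l2sq (f a) := by
            rw [integral_const_mul, integral_const_mul, integral_const_mul, l2sq, l2sq]
    have hsplit : ∫ x, w x * f a x = ∫ x, u x * f a x := by
      have I0 : Integrable fun x => u x * f a x := hu.integrable_mul hfa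
      have Ij : ∀ j, Integrable fun x => c j * (f j x * f a x) := fun j =>
        ((isKacFn_of_isEigenFamily hf j).integrable_mul hfa).const_mul _
      have e1 : ∫ x, w x * f a x = ∫ x, (u x * f a x + ∑ j ∈ s, c j * (f j x * f a x)) :=
        integral_congr_ae (Eventually.of_forall fun x => by
          simp only [hw, Pi.add_apply, add_mul, Finset.sum_mul]; congr 1
          exact Finset.sum_congr rfl fun j _ => by ring)
      rw [e1, integral_add I0 (integrable_finsetSum _ fun j _ => Ij j), integral_finsetSum _ fun j _ => Ij j]
      have hz : ∑ j ∈ s, ∫ x, c j * (f j x * f a x) = 0 := by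
        refine Finset.sum_eq_zero fun j hj => ?_
        rw [integral_const_mul, hf.integral_mul j a, if_neg (show j ≠ a from fun h => ha (h ▸ hj)), mul_zero]
      rw [hz, add_zero]
    have hfa1 : l2sq (f a) = 1 := l2sq_eq_one_of_orthonormal hf.2.2.1 a
    rw [e, hexp, ih, hsplit, hfa1, Finset.sum_insert ha, Finset.sum_insert ha]
    ring

/-- **H3‴ — the almost-orthogonal lower bound at the next level**: for an AL1 eigenfamily `f_0, …, f_m` and every
admissible `u`,  `physLevel (m+2) · (‖u‖² − Σ_j ⟨u,f_j⟩²) ≤ 𝔮(u)`.  (Subtract the projection `Σ⟨u,f_j⟩f_j`; the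
remainder is admissible and orthogonal to all `f_j`, so H3″ applies at `k = m+1`; Pythagoras and
`energyForm_add_span_of_orthogonal` with `E_j ≥ 0`.) [cite: ReedSimonIV1978, Thm. XIII.1] -/
theorem physLevel_mul_sub_le_energyForm (hf : IsEigenFamily m f) (hu : IsKacFn u) :
    physLevel (m + 2) * (l2sq u - ∑ j, (∫ x, u x * f j x) ^ 2) ≤ energyForm u := by
  set c : Fin (m + 1) → ℝ := fun j => ∫ x, u x * f j x with hc
  -- the remainder `v = u − Σ c_j f_j`
  set v : ZM → ℝ := u + fun x => ∑ j, (-c j) * f j x with hv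
  have hS : IsKacFn (fun x => ∑ j, (-c j) * f j x) := isKacFn_span hf (fun j => -c j)
  have hvK : IsKacFn v := hu.add hS
  have huv : u = v + fun x => ∑ j, c j * f j x := by
    funext x
    simp only [hv, Pi.add_apply, neg_mul, Finset.sum_neg_distrib]
    ring
  -- `v ⊥ f_j`
  have hvorth : ∀ j, ∫ x, v x * f j x = 0 := by
    intro j
    have hfj := isKacFn_of_isEigenFamily hf j
    have I0 : Integrable fun x => u x * f j x := hu.integrable_mul hfj
    have Ii : ∀ i, Integrable fun x => (-c i) * (f i x * f j x) := fun i =>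
      ((isKacFn_of_isEigenFamily hf i).integrable_mul hfj).const_mul _
    have e1 : ∫ x, v x * f j x = ∫ x, (u x * f j x + ∑ i, (-c i) * (f i x * f j x)) :=
      integral_congr_ae (Eventually.of_forall fun x => by
        simp only [hv, Pi.add_apply, add_mul, Finset.sum_mul]; congr 1
        exact Finset.sum_congr rfl fun i _ => by ring)
    rw [e1, integral_add I0 (integrable_finsetSum _ fun i _ => Ii i), integral_finsetSum _ fun i _ => Ii i]
    simp_rw [integral_const_mul, hf.integral_mul _ j]
    simp [hc]
  -- H3″ for `v` at `k = m+1`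
  have hH3 := physLevel_mul_l2sq_le_energyForm (k := m + 1) le_rfl hf hvK (fun j _ => hvorth j)
  -- `𝔮(u) = 𝔮(v) + Σ c_j² E_j ≥ 𝔮(v)`
  have hEu : energyForm u = energyForm v + ∑ j, c j ^ 2 * physLevel ((j : ℕ) + 1) := by
    rw [huv]; exact energyForm_add_span_of_orthogonal hf hvK c hvorth
  have hEpos : 0 ≤ ∑ j, c j ^ 2 * physLevel ((j : ℕ) + 1) :=
    Finset.sum_nonneg fun j _ => mul_nonneg (sq_nonneg _) (physLevel_nonneg (Nat.succ_le_succ (Nat.zero_le _)))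
  -- `‖u‖² = ‖v‖² + Σ c_j²`
  have hL : l2sq u = l2sq v + ∑ j, c j ^ 2 := by
    rw [huv, l2sq_add_span hf hvK c]
    simp [hvorth]
  have hsub : l2sq u - ∑ j, (∫ x, u x * f j x) ^ 2 = l2sq v := by
    rw [hL]; simp [hc]
  rw [hsub, show m + 2 = m + 1 + 1 from rfl]
  linarith

end MinMax

end Summit.QuantumFields.YangMills.Theorems.FemtoTransferGap

end
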